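import Summits.BirchSwinnertonDyer.BirchSwinnertonDyer.Theorems.ResidualThetaTransportAtTwoRlfLayerKummerIsotropyLocal
import Summits.BirchSwinnertonDyer.BirchSwinnertonDyer.Theorems.ResidualThetaTransportAtTwoRlfShapiroCupCoboundary
import HarnessLib

/-!
# Route `ResidualThetaTransportAtTwo` (RTT P6, item stmt-BirchSwinnertonDyer-23110, road T), H-PLUSDUAL brick (ISO-1c):
# the layer Kummer classes are ISOTROPIC for the layer cup product of the Shapiro model — `Sh κ_{U_n}(P₁) ∪_{Σe} Sh κ_{U_n}(P₂) = 0`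

Seat `prover-bsd-wall-tp2-p2x` g12 LEAD (`--supports stmt-BirchSwinnertonDyer-23110`). THEOREMS ONLY (no definition, no named fact, no
`sorry`); closes nothing; BSD is NOT proved by any of this.

Assembly of three landed bricks in the K3 layer currency (`…SignedKatoUpToAtTwoLayerPairingModDefs`: `layerGroup κ v n = U_n ≤ Γ_{ℚ_v}`,
`layerKummer` = the subgroup Kummer map of the layer, `layerShapiro` = `shapiroLift`, `layerSumPairing` = `coindFin` of the local Weil
pairing): ISO-1a (w2 g15, `…RlfSubgroupKummerIsotropy`, Poonen–Rains at a layer) → ISO-1b (lead, `…RlfLayerKummerIsotropyLocal`, the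
same in the `subgroupKummerCocycle`/`weilLocalPairing` currency) → w2's `ShapiroCup.cupProduct_shapiroCocycle_eq_zero_of_coboundary`
(`…RlfShapiroCupCoboundary`): for an ALTERNATING Weil datum and any two points `P₁, P₂ ∈ E(ℚ_{n,v})` of the `n`-th local layer,

* **`cupProduct_layerShapiro_layerKummer_eq_zero`** — `(layerSumPairing … n).cupProduct (Sh_n κ_{U_n}(P₁)) (Sh_n κ_{U_n}(P₂)) = 0` in
  `H²(Γ_{ℚ_v}, μ_N|)`;
* `invAt_cupProduct_layerShapiro_layerKummer_eq_zero` — hence its local invariant vanishes: the class–class layer pairing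
  `B_n(κ(P₁), κ(P₂)) = inv_v(Sh κ(P₁) ∪ Sh κ(P₂)) = 0` — the «honest layer Kummer classes are isotropic» input of the layer
  self-isotropy (S) in the lead's ISO plan for Kim 2007 Prop. 3.15 at `2` (NOTES `## ISO ARCHITECTURE`).

References: [PoonenRains2012] Prop. 4.8; [BDKim2007] Prop. 3.15 (pp. 56–57); [Kobayashi2003] (8.23); [NeukirchSchmidtWingberg2008] I §5–§6.
-/

-- the Theorems namespace of this sub repeats the summit name by design (D-0017 nested layout)
set_option linter.dupNamespace false

noncomputable section

open scoped Classical Topology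

namespace Summit.BirchSwinnertonDyer.BirchSwinnertonDyer.Theorems.SignedEC.LayerKummerIso

open CategoryTheory Field NumberField IsDedekindDomain WeierstrassCurve Literature.NumberTheory.EllipticCurves
  Literature.NumberTheory.GaloisRepresentations Literature.NumberTheory.EllipticCurves.Kobayashi2003
open Summit.BirchSwinnertonDyer.BirchSwinnertonDyer.Theorems.SignedKatoOffTwo.LayerPairing

-- Cup products need `LocallyCompactSpace Γ_v`; as in the K3 layer-pairing files the compactness of absolute Galois groups is a
-- local instance only.
attribute [local instance] absoluteGaloisGroup_compactSpace

variable (W : WeierstrassCurve ℚ) [W.IsElliptic] (N : ℕ) [NeZero N]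
  (e : geomTorsion W N → geomTorsion W N → AlgebraicClosure ℚ) (hμ : ∀ S T, e S T ^ N = 1)
  (hadd₁ : ∀ S₁ S₂ T, e (S₁ + S₂) T = e S₁ T * e S₂ T) (hadd₂ : ∀ S T₁ T₂, e S (T₁ + T₂) = e S T₁ * e S T₂)
  (hgal : ∀ (σ : absoluteGaloisGroup ℚ) (S T : geomTorsion W N), σ • e S T = e (σ • S) (σ • T))
  {p : ℕ} [Fact p.Prime] (κ : ZpExtension ℚ p) (v : HeightOneSpectrum (𝓞 ℚ))

/-- **The layer Kummer classes are isotropic in the Shapiro model.** For an alternating Weil datum `e` on `E[N]`, a layer `n` of the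
local tower at `v` and points `P₁, P₂ ∈ E(ℚ_{n,v})`: `Sh_n(κ_{U_n}(P₁)) ∪_{Σe} Sh_n(κ_{U_n}(P₂)) = 0` in `H²(Γ_{ℚ_v}, μ_N|)`.
[cite: PoonenRains2012, Prop. 4.8] [cite: BDKim2007, Prop. 3.15] -/
theorem cupProduct_layerShapiro_layerKummer_eq_zero (halt : ∀ T, e T T = 1) (n : ℕ)
    (P₁ P₂ : localLayerPointsOfEmb κ (closureEmb (K := ℚ) (v.adicCompletion ℚ)) W n) :
    (layerSumPairing W N e hμ hadd₁ hadd₂ hgal κ v n).cupProduct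
        (layerShapiro W N κ v n (layerKummer W N κ v n P₁)) (layerShapiro W N κ v n (layerKummer W N κ v n P₂)) = 0 := by
  have hn : ((N : ℕ) : ℤ) ≠ 0 := by exact_mod_cast (NeZero.ne N)
  letI : Fintype (absoluteGaloisGroup (v.adicCompletion ℚ) ⧸ layerGroup κ v n) := layerFintypeQuot κ v n
  -- `N`-th roots of the points and their Kummer cocycles
  let Q₁ : localPoints W (v.adicCompletion ℚ) := W.subgroupZSMulRoot ((N : ℕ) : ℤ) hn (P₁ : localPoints W (v.adicCompletion ℚ))
  let Q₂ : localPoints W (v.adicCompletion ℚ) := W.subgroupZSMulRoot ((N : ℕ) : ℤ) hn (P₂ : localPoints W (v.adicCompletion ℚ))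
  have hQ₁ : ((N : ℕ) : ℤ) • Q₁ = (P₁ : localPoints W (v.adicCompletion ℚ)) := W.zsmul_subgroupZSMulRoot _ hn _
  have hQ₂ : ((N : ℕ) : ℤ) • Q₂ = (P₂ : localPoints W (v.adicCompletion ℚ)) := W.zsmul_subgroupZSMulRoot _ hn _
  have hQ₁fix : ((N : ℕ) : ℤ) • Q₁ ∈ FixedPoints.addSubgroup (layerGroup κ v n) (localPoints W (v.adicCompletion ℚ)) := by
    rw [hQ₁]; exact P₁.2
  have hQ₂fix : ((N : ℕ) : ℤ) • Q₂ ∈ FixedPoints.addSubgroup (layerGroup κ v n) (localPoints W (v.adicCompletion ℚ)) := by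
    rw [hQ₂]; exact P₂.2
  have hK₁ : layerKummer W N κ v n P₁ = oneCocycleClass _ (W.subgroupKummerCocycle ((N : ℕ) : ℤ) (layerGroup κ v n) hn Q₁ hQ₁fix) := by
    change W.subgroupKummerMap ((N : ℕ) : ℤ) (layerGroup κ v n) _ P₁ = _
    rw [W.subgroupKummerMap_apply_eq ((N : ℕ) : ℤ) (layerGroup κ v n) hn P₁ Q₁ hQ₁fix hQ₁]
    rfl
  have hK₂ : layerKummer W N κ v n P₂ = oneCocycleClass _ (W.subgroupKummerCocycle ((N : ℕ) : ℤ) (layerGroup κ v n) hn Q₂ hQ₂fix) := by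
    change W.subgroupKummerMap ((N : ℕ) : ℤ) (layerGroup κ v n) _ P₂ = _
    rw [W.subgroupKummerMap_apply_eq ((N : ℕ) : ℤ) (layerGroup κ v n) hn P₂ Q₂ hQ₂fix hQ₂]
    rfl
  -- ISO-1b: the cup-product cochain of the two Kummer cocycles is a coboundary on `U_n`
  obtain ⟨β, hβ⟩ := exists_coboundary_weilLocalPairing_subgroupKummerCocycle W N e hμ hadd₁ hadd₂ hgal halt v hn (layerGroup κ v n)
    (Subgroup.isClosed_of_isOpen _ (isOpen_layerGroup κ v n)) Q₁ Q₂ hQ₁fix hQ₂fix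
  -- Shapiro
  have key := ShapiroCup.cupProduct_shapiroCocycle_eq_zero_of_coboundary (weilLocalPairing W N e hμ hadd₁ hadd₂ hgal v) (layerGroup κ v n)
    (isOpen_layerGroup κ v n) (layerReps_spec κ v n) _ _ β hβ
  have h1 : layerShapiro W N κ v n (layerKummer W N κ v n P₁) = oneCocycleClass _
      (shapiroCocycle (torsionLocalRep W N v) (layerGroup κ v n) (isOpen_layerGroup κ v n) (layerReps_spec κ v n)
        (W.subgroupKummerCocycle ((N : ℕ) : ℤ) (layerGroup κ v n) hn Q₁ hQ₁fix)) := by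
    rw [hK₁]
    exact shapiroLift_oneCocycleClass (torsionLocalRep W N v) (layerGroup κ v n) (isOpen_layerGroup κ v n) (layerReps_spec κ v n)
      (layerReps_one κ v n) _
  have h2 : layerShapiro W N κ v n (layerKummer W N κ v n P₂) = oneCocycleClass _
      (shapiroCocycle (torsionLocalRep W N v) (layerGroup κ v n) (isOpen_layerGroup κ v n) (layerReps_spec κ v n)
        (W.subgroupKummerCocycle ((N : ℕ) : ℤ) (layerGroup κ v n) hn Q₂ hQ₂fix)) := by
    rw [hK₂]
    exact shapiroLift_oneCocycleClass (torsionLocalRep W N v) (layerGroup κ v n) (isOpen_layerGroup κ v n) (layerReps_spec κ v n)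
      (layerReps_one κ v n) _
  have h3 : layerSumPairing W N e hμ hadd₁ hadd₂ hgal κ v n = (weilLocalPairing W N e hμ hadd₁ hadd₂ hgal v).coindFin (layerGroup κ v n) :=
    rfl
  rw [h1, h2, h3]
  exact key

/-- **Hence the class–class layer pairing vanishes on layer Kummer classes**: `inv_v(Sh κ(P₁) ∪_{Σe} Sh κ(P₂)) = 0`.
[cite: BDKim2007, Prop. 3.15 (pp. 56–57)] [cite: Kobayashi2003, (8.23) (p. 18)] -/
theorem invAt_cupProduct_layerShapiro_layerKummer_eq_zero (halt : ∀ T, e T T = 1) (n : ℕ)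
    (P₁ P₂ : localLayerPointsOfEmb κ (closureEmb (K := ℚ) (v.adicCompletion ℚ)) W n) :
    invAt N v ((layerSumPairing W N e hμ hadd₁ hadd₂ hgal κ v n).cupProduct
        (layerShapiro W N κ v n (layerKummer W N κ v n P₁)) (layerShapiro W N κ v n (layerKummer W N κ v n P₂))) = 0 := by
  rw [cupProduct_layerShapiro_layerKummer_eq_zero W N e hμ hadd₁ hadd₂ hgal κ v halt n P₁ P₂, map_zero]

end Summit.BirchSwinnertonDyer.BirchSwinnertonDyer.Theorems.SignedEC.LayerKummerIso

end
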